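import Mathlib
import Summits.Ventures.HodgeRepro2.Tier7.Target
import Summits.Ventures.HodgeRepro2.Tier7.Line3.Defs
import Summits.Ventures.HodgeRepro2.Tier7.Line2.GaloisDefs

/-!
# Tier7/Line2/Galois — realizations, the permuted datum, LEMMA C and THE BRIDGE (SUPPORT for Line 3's residual)

SPLIT (2) of the Galois module (t7-plan-2's split ruling, STATUS l. 14988): imports `Tier7/Line2/GaloisDefs.lean`
(§1–§3: `RationalStructure`, `eigenPeriod`, `GaloisRationality`, LEMMA A, the reordering lemmas) and adds §4
`permOmega` / `permEps` / `Realization` / `exists_perm_of_pair` / `reindex_mem_h10` / `PermDatum`, LEMMA C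
`permDatum_L2` (PROVED, t7-L1-p4), and §5 THE BRIDGE `conclusion_perm_iff` / `rtfConclusion_perm_iff` under the
displayed `GaloisRationality` (proved for every `R` in `GaloisPeriod.lean`, p5; the unconditional bridge in
`GaloisBridge.lean`). Statements verbatim from t7-plan-2's v3 (route/t7/Line2/Galois.lean 29201098…); the v3 module
docstring is carried by `GaloisDefs.lean`. Lane: support, NOT a device. §8(d): NO.
-/

namespace Summit.Ventures.HodgeRepro2.Tier7.Line2.Galois

open Summit.Ventures.HodgeRepro2 (IsWeilFace IsCMType)
open Summit.Ventures.HodgeRepro2.T6 (KC H1C eigenLine eigenLineK)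
open Summit.Ventures.HodgeRepro2.Tier7

noncomputable section

variable {K : Type} [Field K] [NumberField K] {E' : Type} [Field E'] [NumberField E']
  {V : Type} [AddCommGroup V] [Module E' V] {HX : Type} [Ring HX] [Algebra ℂ HX]
  {G : Type} [Group G] [MulAction G HX]

variable {D : PeriodDatum K E' V HX G}

/-! ## 4. Realizations and the permuted datum -/

/-- the summands of the realization `(σ, π)`: corners `π 0, π 1` at `σ`, corners `π 2, π 3` at `σ̄` -/
def permOmega (R : RationalStructure D) (σ : K →+* ℂ) (π : Equiv.Perm (Fin 4)) (i : Fin 4) : Submodule ℂ HX :=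
  R.omegaAt (π i) (if i.val < 2 then σ else conjEmb σ)

/-- the eigen-idempotent of the realization at corner `i`: `ε_σ` for `i = 0, 1`, `ε_{σ̄}` for `i = 2, 3` -/
def permEps (R : RationalStructure D) (σ : K →+* ℂ) (i : Fin 4) : KC K :=
  R.eps (if i.val < 2 then σ else conjEmb σ)

/-- A realization of the face: an embedding `σ` and a corner permutation `π` with `σ ∈ T (π 0) ∩ T (π 1)`,
`σ̄ ∈ T (π 2) ∩ T (π 3)`, together with the two admitted hypotheses of the sentence for the conjugated quadruple:
(H11b) central match for the summands `permOmega` (the central character of a conjugated summand is the conjugated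
character, and `μ_0 μ_1 = μ_2 μ_3` is `τ`-invariant: CENSUS-g1.md §3(3)) and (H12) for the plane
`W_{π0} ⊕ W_{π1}` against `W_{π2} ⊕ W_{π3}` (CENSUS-g1.md §3(2)). The base realization is `(s, 1)`. -/
structure Realization (R : RationalStructure D) where
  σ : K →+* ℂ
  π : Equiv.Perm (Fin 4)
  h0 : σ ∈ D.F.T (π 0)
  h1 : σ ∈ D.F.T (π 1)
  h2 : conjEmb σ ∈ D.F.T (π 2)
  h3 : conjEmb σ ∈ D.F.T (π 3)
  /-- (H11b) for the conjugated quadruple -/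
  center_match : ∀ z ∈ Subgroup.center G, ∀ a : Fin 4 → HX, (∀ i, a i ∈ permOmega R σ π i) →
    z • (a 0 * a 1 * D.S.bar (a 2 * a 3)) = a 0 * a 1 * D.S.bar (a 2 * a 3)
  /-- (H12) for the realization's plane -/
  disc : Fin 4 → E'
  disc_plus : ∀ i, D.E.conj (disc i) = disc i
  disc_ne : ∀ i, disc i ≠ 0
  disc_match : ∃ y : E', y ≠ 0 ∧ disc 0 * disc 1 = disc 2 * disc 3 * (y * D.E.conj y)

omit [NumberField K] in
/-- Every pair of corners sharing an embedding gives the corner data of a realization (`IsWeilFace`: `σ` lies in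
exactly two types, and the other two types contain `σ̄`). -/
theorem exists_perm_of_pair {T : Fin 4 → Set (K →+* ℂ)} (hT : IsWeilFace K T) {σ : K →+* ℂ} {i j : Fin 4}
    (hij : i ≠ j) (hi : σ ∈ T i) (hj : σ ∈ T j) :
    ∃ π : Equiv.Perm (Fin 4), π 0 = i ∧ π 1 = j ∧ conjEmb σ ∈ T (π 2) ∧ conjEmb σ ∈ T (π 3) := by
  classical
  have hcard : ∀ φ : K →+* ℂ, (Finset.univ.filter fun l => φ ∈ T l).card = 2 := fun φ => by
    rw [← Fintype.card_subtype, ← Nat.card_eq_fintype_card]; exact hT.2 φ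
  have hnot : ∀ k, k ≠ i → k ≠ j → σ ∉ T k := by
    intro k hki hkj hk
    have h3 : 2 < (Finset.univ.filter fun l => σ ∈ T l).card := by
      rw [Finset.two_lt_card_iff]
      exact ⟨i, j, k, by simpa using hi, by simpa using hj, by simpa using hk, hij, hki.symm, hkj.symm⟩
    rw [hcard] at h3; exact lt_irrefl _ h3
  have hconj : ∀ k, σ ∉ T k → conjEmb σ ∈ T k := by
    intro k hk
    have hx := (hT.1 k σ).or.resolve_left hk
    have : NumberField.ComplexEmbedding.conjugate σ = conjEmb σ := RingHom.ext fun x => rfl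
    rwa [this] at hx
  set j' := Equiv.swap (0 : Fin 4) i j with hj'
  have hj'0 : j' ≠ 0 := by
    intro h
    apply hij
    have := congrArg (Equiv.swap (0 : Fin 4) i) h
    rw [hj', Equiv.swap_apply_self, Equiv.swap_apply_left] at this
    exact this.symm
  set π : Equiv.Perm (Fin 4) := (Equiv.swap (1 : Fin 4) j').trans (Equiv.swap (0 : Fin 4) i) with hπ
  have hπ0 : π 0 = i := by
    simp only [hπ, Equiv.trans_apply]
    rw [Equiv.swap_apply_of_ne_of_ne (by decide) hj'0.symm, Equiv.swap_apply_left]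
  have hπ1 : π 1 = j := by
    simp only [hπ, Equiv.trans_apply]
    rw [Equiv.swap_apply_left, hj', Equiv.swap_apply_self]
  refine ⟨π, hπ0, hπ1, ?_, ?_⟩
  · apply hconj; apply hnot
    · rw [← hπ0]; exact fun h => absurd (π.injective h) (by decide)
    · rw [← hπ1]; exact fun h => absurd (π.injective h) (by decide)
  · apply hconj; apply hnot
    · rw [← hπ0]; exact fun h => absurd (π.injective h) (by decide)
    · rw [← hπ1]; exact fun h => absurd (π.injective h) (by decide)

/-- the realization's idempotent at corner `i` lies in the corresponding eigenline of `K ⊗ ℂ` -/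
theorem permEps_mem (R : RationalStructure D) (σ : K →+* ℂ) (i : Fin 4) :
    permEps R σ i ∈ eigenLineK K (if i.val < 2 then σ else conjEmb σ) := by
  intro x
  exact R.eps_eigen _ x

/-- `reindex π` carries the `i`-th eigenline to the `π i`-th one -/
theorem reindex_eigenLine (π : Equiv.Perm (Fin 4)) (i : Fin 4) (σ : K →+* ℂ) :
    (eigenLine K i σ).map (reindex π) = eigenLine K (π i) σ := by
  unfold eigenLine
  rw [← Submodule.map_comp]
  congr 1
  exact LinearMap.ext fun u => reindex_slot π i u

/-- re-indexing preserves the holomorphic part: `reindex π` maps `(T ∘ π).h10` into `T.h10` -/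
theorem reindex_mem_h10 (F : Face K) (π : Equiv.Perm (Fin 4)) (v : H1C K)
    (hv : v ∈ (Face.mk (fun i => F.T (π i)) (isWeilFace_comp_perm F.face π)).h10) :
    reindex π v ∈ F.h10 := by
  have hle : (Face.mk (fun i => F.T (π i)) (isWeilFace_comp_perm F.face π)).h10 ≤
      F.h10.comap (reindex π) := by
    unfold Face.h10
    refine iSup_le fun i => iSup₂_le fun σ hσ => ?_
    rw [← Submodule.map_le_iff_le_comap, reindex_eigenLine]
    exact le_iSup_of_le (π i) (le_iSup₂_of_le σ hσ le_rfl)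
  exact hle hv

/-- THE PERMUTED DATUM: the same field, space, shadow; corners permuted by `π`; base embedding `σ`;
eigenvectors the idempotents; summands `omegaAt`; (H11b)/(H12) from the realization. -/
def PermDatum (R : RationalStructure D) (r : Realization R) : PeriodDatum K E' V HX G where
  E := D.E
  Vh := D.Vh
  S := D.S
  F := Face.mk (fun i => D.F.T (r.π i)) (isWeilFace_comp_perm D.F.face r.π)
  alb := D.alb ∘ₗ reindex r.π
  alb_inj := by
    intro v w h
    have hr : Function.Injective (reindex (K := K) r.π) :=
      LinearMap.funLeft_injective_of_surjective ℂ (KC K) r.π.symm r.π.symm.surjective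
    exact hr (D.alb_inj h)
  alb_h10 := fun v hv => D.alb_h10 _ (reindex_mem_h10 D.F r.π v hv)
  s := r.σ
  hs0 := r.h0
  hs1 := r.h1
  hs2 := r.h2
  hs3 := r.h3
  e := fun i => slot i (permEps R r.σ i)
  e0_mem := Submodule.mem_map_of_mem (permEps_mem R r.σ 0)
  e1_mem := Submodule.mem_map_of_mem (permEps_mem R r.σ 1)
  e2_mem := Submodule.mem_map_of_mem (permEps_mem R r.σ 2)
  e3_mem := Submodule.mem_map_of_mem (permEps_mem R r.σ 3)
  e_ne := by
    intro i h
    have h' := congrFun h i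
    simp only [slot, LinearMap.single_apply, Pi.single_eq_same, Pi.zero_apply] at h'
    exact R.eps_ne _ h'
  omega := permOmega R r.σ r.π
  omega_le := by
    intro i
    fin_cases i
    · exact R.omegaAt_le _ _ r.h0
    · exact R.omegaAt_le _ _ r.h1
    · exact R.omegaAt_le _ _ r.h2
    · exact R.omegaAt_le _ _ r.h3
  omega_irred := fun i => R.omegaAt_irred _ _
  theta_mem := by
    intro i
    show D.alb (reindex r.π (slot i (permEps R r.σ i))) ∈ permOmega R r.σ r.π i
    rw [reindex_slot]
    exact R.alb_eps_mem _ _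
  center_scalar := fun i => R.omegaAt_center_scalar _ _
  center_match := r.center_match
  disc := r.disc
  disc_plus := r.disc_plus
  disc_ne := r.disc_ne
  disc_match := r.disc_match

/-- `permEps` at corner `0` -/
theorem permEps_zero (R : RationalStructure D) (σ : K →+* ℂ) : permEps R σ 0 = R.eps σ := rfl
/-- `permEps` at corner `1` -/
theorem permEps_one (R : RationalStructure D) (σ : K →+* ℂ) : permEps R σ 1 = R.eps σ := rfl
/-- `permEps` at corner `2` -/
theorem permEps_two (R : RationalStructure D) (σ : K →+* ℂ) : permEps R σ 2 = R.eps (conjEmb σ) := rfl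
/-- `permEps` at corner `3` -/
theorem permEps_three (R : RationalStructure D) (σ : K →+* ℂ) : permEps R σ 3 = R.eps (conjEmb σ) := rfl

/-- the translated theta lifts of the permuted datum, explicitly -/
theorem permDatum_theta (R : RationalStructure D) (r : Realization R) (g : Fin 4 → G) (i : Fin 4) :
    (PermDatum R r).theta g i = g i • D.alb (slot (r.π i) (permEps R r.σ i)) := by
  show g i • D.alb (reindex r.π (slot i (permEps R r.σ i))) = _
  rw [reindex_slot]

/-- LEMMA C. The pairing of the permuted datum is the σ-eigen-period of the re-indexed translates up to the sign of
`π`: `bar` turns the `σ̄`-side into the `σ`-side (`alb_conj`, `eps_conj`, `conjH1_slot`), `reindex_slot` moves the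
corners, and `anticomm` reorders the four 1-classes (`Equiv.Perm.sign`). -/
theorem permDatum_L2 (R : RationalStructure D) (r : Realization R) (g : Fin 4 → G) :
    (PermDatum R r).S.L2 ((PermDatum R r).fOmegaS g) ((PermDatum R r).fOmegaSbar g) =
      ((Equiv.Perm.sign r.π : ℤ) : ℂ) * eigenPeriod R r.σ (fun k => g (r.π.symm k)) := by
  set b : Fin 4 → HX := fun k => g (r.π.symm k) • D.alb (slot k (R.eps r.σ)) with hb
  have hac : ∀ k l, b k * b l = -(b l * b k) := fun k l => R.anticomm _ _ _ _
  have hL : (PermDatum R r).S.L2 ((PermDatum R r).fOmegaS g) ((PermDatum R r).fOmegaSbar g) =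
      D.S.intX (b (r.π 0) * b (r.π 1) * (b (r.π 2) * b (r.π 3))) := by
    show D.S.intX ((PermDatum R r).fOmegaS g * D.S.bar ((PermDatum R r).fOmegaSbar g)) = _
    simp only [PeriodDatum.fOmegaS, PeriodDatum.fOmegaSbar, permDatum_theta, permEps_zero, permEps_one,
      permEps_two, permEps_three, D.S.bar_mul, bar_smul_alb_eps, hb, Equiv.symm_apply_apply]
  have hE : eigenPeriod R r.σ (fun k => g (r.π.symm k)) = D.S.intX (b 0 * b 1 * b 2 * b 3) := rfl
  rw [hL, hE, ← mul_assoc, prod_perm_eq_sign_zsmul b hac r.π, map_zsmul, zsmul_eq_mul]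

/-! ## 5. THE BRIDGE (sorry-free from A, C and Galois rationality) -/

/-- the sign of a permutation is a non-zero complex number -/
theorem sign_ne_zero (π : Equiv.Perm (Fin 4)) : ((Equiv.Perm.sign π : ℤ) : ℂ) ≠ 0 := by
  have : (Equiv.Perm.sign π : ℤ) ≠ 0 := Units.ne_zero _
  exact_mod_cast this

/-- THE KERNEL BRIDGE: the conclusion `C` for the permuted datum is equivalent to the conclusion for `D`
(uniform in `D`; proved from LEMMAS A, C and Galois rationality `hB` — discharged for every `R` by
`GaloisPeriod.galoisRationality`, so the unconditional form is `conclusion_perm_iff_of_galois (galoisRationality R) r`). -/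
theorem conclusion_perm_iff {R : RationalStructure D} (hB : GaloisRationality R) (r : Realization R) :
    (∃ g : Fin 4 → G, (PermDatum R r).S.L2 ((PermDatum R r).fOmegaS g) ((PermDatum R r).fOmegaSbar g) ≠ 0) ↔
      (∃ g : Fin 4 → G, D.S.L2 (D.fOmegaS g) (D.fOmegaSbar g) ≠ 0) := by
  obtain ⟨c, hc0, hc⟩ := L2_eq_mul_eigenPeriod R
  constructor
  · rintro ⟨g, hg⟩
    refine ⟨fun k => g (r.π.symm k), ?_⟩
    rw [hc]
    rw [permDatum_L2] at hg
    have h1 : eigenPeriod R r.σ (fun k => g (r.π.symm k)) ≠ 0 :=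
      fun h => hg (by rw [h, mul_zero])
    exact mul_ne_zero hc0 ((eigenPeriod_ne_zero_iff hB r.σ D.s _).1 h1)
  · rintro ⟨g, hg⟩
    refine ⟨fun i => g (r.π i), ?_⟩
    rw [permDatum_L2]
    have h1 : eigenPeriod R D.s g ≠ 0 := by
      rw [hc] at hg
      exact fun h => hg (by rw [h, mul_zero])
    have h2 : eigenPeriod R r.σ (fun k => g (r.π (r.π.symm k))) ≠ 0 := by
      have : (fun k => g (r.π (r.π.symm k))) = g := by funext k; simp
      rw [this]
      exact (eigenPeriod_ne_zero_iff hB D.s r.σ g).1 h1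
    exact mul_ne_zero (sign_ne_zero r.π) h2

/-- Transport of `Line3.RtfConclusion` under any per-datum bridge `RtfConclusion D' ↔ C D'` (the cell's landed
bridges: `rtfConclusion_iff_conclusion_of_retraction` p666660, `…_of_irred_finiteDimensional` p666013, with their
hypotheses supplied for both data). -/
theorem rtfConclusion_perm_iff {R : RationalStructure D} (hB : GaloisRationality R) (r : Realization R)
    (hbridge : ∀ D' : PeriodDatum K E' V HX G,
      Line3.RtfConclusion D' ↔ (∃ g : Fin 4 → G, D'.S.L2 (D'.fOmegaS g) (D'.fOmegaSbar g) ≠ 0)) :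
    Line3.RtfConclusion (PermDatum R r) ↔ Line3.RtfConclusion D := by
  rw [hbridge, hbridge]
  exact conclusion_perm_iff hB r

/-! ## 6. (A′) pre-emption — moved to separate modules (no `sorry` at the gate)

`Tier7/Line2/Eps.lean` (t7-L1-p3): the splitting `K ⊗_ℚ ℂ ≅ ∏_σ ℂ` — an `eps` with `eps_eigen`, `eps_ne`, `eps_sum`,
`eigen_dim`, `eps_conj` for every number field `K`. `Tier7/Line2/SquareZeroInstance.lean` (imports this module + `Eps`):
any datum whose shadow is square-zero on 1-classes (`alb v * alb w = 0`), with `intX = 0`, `bar ∘ alb = alb ∘ conjH1`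
and a trivial Hecke action, carries a `RationalStructure` — in particular the junk datum of the frozen counter-model
(crit-1 JunkModel-frozen 9c0b26dd…), so no field of the interface closes `C D` on its own. -/

end

end Summit.Ventures.HodgeRepro2.Tier7.Line2.Galois
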